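import Mathlib
import Summits.Ventures.PercRepro2.HCov
import Summits.Ventures.PercRepro2.BHKOutside
import Summits.Ventures.PercRepro2.BHKAvoid
import Summits.Ventures.PercRepro2.ISplit
import Summits.Ventures.PercRepro2.CrossClusterFunctional
import Summits.Ventures.PercRepro2.FirstOrderTerms
import Summits.Ventures.PercRepro2.FirstOrderSlopeG
import Summits.Ventures.PercRepro2.PendantWKernel
import Summits.Ventures.PercRepro2.PendantW
import Summits.Ventures.PercRepro2.PendantCovMass
import Summits.Ventures.PercRepro2.PendantDmixCov
import Summits.Ventures.PercRepro2.PendantB2Dict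

import Summits.Ventures.PercRepro2.PendantDeficit
/-!
# `D(β, γ) ≥ 0` on every instance — the open piece of the degree-one-root contraction is a theorem
(blind cell PercRepro2, p5 g23; `proofs/P5-OEDGE.md` §29 addendum 1, `S4-HARDSTEP.md` v98)

`Dmix = D·E[(L_b − β)(L_o − γ); T] ≥ 0` (`Dmix_nonneg`), by the C₂-exploration in three steps:

1. `Z·Dmix ≥ D·Dmix_R` where `Dmix_R := Z·t_bo − β·Z·t_o − r_o·t_b + β·r_o·t` is `Z·D·D(β, γ_R)`,
   `γ_R = P(o ∈ C₁ | R)`, `R = {a₁ ↮ a₂, a₃}` (the `D_o`-slope `β·t − t_b ≥ 0` and `D·r_o ≤ Z·D_o`);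
2. `Dmix_R ≥ Z·E[m·u_b·u_o] − β·Z·t_o − r_o·t_b + β·r_o·t` by Harris in the fibre `G ∖ C₂`
   (`P(b, o ∈ C₁ | C₂) ≥ P(b ∈ C₁ | C₂)·P(o ∈ C₁ | C₂)`, `delClusterProb_mul_le_inter`), with
   `m = 1_{a₃ ∈ C₂}`, `u_x = 1_{a₁ ∉ C₂}·P_{G ∖ C₂}(x ∈ C₁)`;
3. the last expression is `≥ 0` by the functional cross-cluster inequality under the avoidance
   `R` (`bhk_cross_functional_avoid`, `s = a₁`, `t = a₂`, `X = {a₂, a₃}`): the increasing functional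
   `F = 1_{a₃ ∈ C₂}·(β − g_b(C₂))` of `C₂` (the b-deficit of the explored cluster) and the increasing
   event `o ∈ C₁` are negatively correlated given `R`, which reads
   `Z·E[F·1_{o ∈ C₁}; R] ≤ E[F; R]·P(R, o ∈ C₁)`; by the tower identity (`expect_cross_avoid_eq`)
   `E[F·1_{o ∈ C₁}; R] = E[m·(β − g_b)·u_o]` and `E[F; R] = β·t − t_b`.

Hence, with `PendantB2Dict.HCov_pendant_root_of_Dmix`, `(HCOV)` is closed under attaching a root of
degree one on every non-degenerate instance: **`HCov_pendant_root`** (the degree-one-root contraction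
of the crux's (HCOV), the class theorem §27 (3) asked for, unconditional).
-/

namespace Summit.Ventures.PercRepro2

open UnionCluster

namespace CovForm

namespace FirstOrder

section Main

variable {V : Type*} {E : Type*} [Fintype E] [DecidableEq E] [Fintype V] [DecidableEq V]
  {R : Type*} [Field R] [LinearOrder R] [IsStrictOrderedRing R]

/-- **`Dmix_R ≥ 0` up to the fibre Harris surplus** — the functional cross-cluster inequality under
`R = {a₁ ↮ a₂, a₃}` for the b-deficit `F = 1_{a₃ ∈ C₂}·(β − g_b(C₂))` and the event `o ∈ C₁`:
`0 ≤ Z·E[m·u_b·u_o] − β·Z·t_o − r_o·t_b + β·r_o·t`. -/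
theorem cross_deficit (p : E → R) (hp : IsProbVec p) (ends : E → Sym2 V) (o a₁ a₂ a₃ b : V) :
    0 ≤ prob p (avoidAll ends a₁ {a₂, a₃}) *
          expect p (fun ω => iI ends a₂ a₃ ω * (uO p ends a₁ a₂ b ω * uO p ends a₁ a₂ o ω)) -
        beta p ends a₁ b * prob p (avoidAll ends a₁ {a₂, a₃}) *
          prob p (TEvent ends a₁ a₂ a₃ ∩ connEvent ends a₁ o) -
        prob p (avoidAll ends a₁ {a₂, a₃} ∩ connEvent ends a₁ o) *
          prob p (TEvent ends a₁ a₂ a₃ ∩ connEvent ends a₁ b) +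
        beta p ends a₁ b * prob p (avoidAll ends a₁ {a₂, a₃} ∩ connEvent ends a₁ o) *
          prob p (TEvent ends a₁ a₂ a₃) := by
  classical
  set β := beta p ends a₁ b with hβ
  set Rev := avoidAll ends a₁ {a₂, a₃} with hRev
  -- the functional cross-cluster inequality
  have hF₁ : Monotone (({W : Set V | o ∈ W}).indicator (1 : Set V → R)) :=
    monotone_indicator_one_of_isUpperSet (isUpperSet_mem_setOf o)
  have hF₁0 : ∀ S, 0 ≤ ({W : Set V | o ∈ W}).indicator (1 : Set V → R) S :=
    fun _ => Set.indicator_apply_nonneg fun _ => zero_le_one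
  have hΨ : Antitone (fun K => β - defB p ends a₁ a₃ b K) :=
    fun K K' h => sub_le_sub_left (defB_mono p hp ends a₁ a₃ b h) _
  have hΨ0 : ∀ K, 0 ≤ β - defB p ends a₁ a₃ b K :=
    fun K => sub_nonneg.2 (defB_le_beta p hp ends a₁ a₃ b K)
  have h := bhk_cross_functional_avoid p hp ends a₁ a₂ (X := ({a₂, a₃} : Finset V))
    (Finset.mem_insert_self a₂ {a₃}) hF₁ hF₁0 hΨ hΨ0
  -- (i) `E[1_{o ∈ C₁} 1_R] = P(R, o ∈ C₁)`
  have e1 : expect p (fun ω => ({W : Set V | o ∈ W}).indicator (1 : Set V → R) (cluster ends ω a₁) *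
      Rev.indicator 1 ω) = prob p (Rev ∩ connEvent ends a₁ o) := by
    rw [prob_eq_expect_indicator, Set.inter_comm, Set.inter_indicator_one]
    refine congrArg (expect p) (funext fun ω => ?_)
    rw [Pi.mul_apply]
    by_cases hc : cluster ends ω a₁ ∈ {W : Set V | o ∈ W}
    · rw [Set.indicator_of_mem hc, Set.indicator_of_mem (show ω ∈ connEvent ends a₁ o from hc)]
      rfl
    · rw [Set.indicator_of_notMem hc, Set.indicator_of_notMem (show ω ∉ connEvent ends a₁ o from hc)]
  -- (ii) `E[(β − F(C₂)) 1_R] = β·Z − (β·t − t_b)`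
  have e2 : expect p (fun ω => (β - defB p ends a₁ a₃ b (cluster ends ω a₂)) * Rev.indicator 1 ω) =
      β * prob p Rev - (β * prob p (TEvent ends a₁ a₂ a₃) -
        prob p (TEvent ends a₁ a₂ a₃ ∩ connEvent ends a₁ b)) := by
    rw [mass_T, mass_TbL, prob_eq_expect_indicator]
    unfold expect
    simp only [Finset.mul_sum, ← Finset.sum_sub_distrib]
    refine Finset.sum_congr rfl fun ω _ => ?_
    rw [defB_apply]
    have := iI_mul_indicator_R (R := R) ends a₁ a₂ a₃ ω
    rw [← hRev] at this
    have hu := rI_mul_delClusterProb p ends a₁ a₂ b ω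
    calc weight p ω * ((β - iI ends a₂ a₃ ω *
            (β - delClusterProb p ends a₁ {W | b ∈ W} (cluster ends ω a₂))) * Rev.indicator 1 ω)
        = weight p ω * (β * Rev.indicator 1 ω) - weight p ω * ((iI ends a₂ a₃ ω * Rev.indicator 1 ω) *
            (β - delClusterProb p ends a₁ {W | b ∈ W} (cluster ends ω a₂))) := by ring
      _ = weight p ω * (β * Rev.indicator 1 ω) - weight p ω * ((iI ends a₂ a₃ ω * rI ends a₁ a₂ ω) *
            (β - delClusterProb p ends a₁ {W | b ∈ W} (cluster ends ω a₂))) := by rw [this]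
      _ = β * (weight p ω * Rev.indicator 1 ω) - (β * (weight p ω * (iI ends a₂ a₃ ω * rI ends a₁ a₂ ω)) -
            weight p ω * (iI ends a₂ a₃ ω * uO p ends a₁ a₂ b ω)) := by rw [← hu]; ring
  -- (iii) `E[1_{o ∈ C₁} (β − F(C₂)) 1_R] = β·r_o − (β·t_o − E[m·u_b·u_o])`
  have hQi : ∀ ω, (avoidAll ends a₂ {a₁}).indicator (1 : Config E → R) ω = rI ends a₁ a₂ ω :=
    fun ω => rfl
  have tower := expect_cross_avoid_eq p ends a₂ a₁ (X := ({a₁} : Finset V))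
    (Finset.mem_singleton_self a₁) (defB p ends a₁ a₃ b) (({W : Set V | o ∈ W}).indicator 1)
  simp only [delExpect_indicator_eq', hQi] at tower
  have e3 : expect p (fun ω => ({W : Set V | o ∈ W}).indicator (1 : Set V → R) (cluster ends ω a₁) *
      (β - defB p ends a₁ a₃ b (cluster ends ω a₂)) * Rev.indicator 1 ω) =
      β * prob p (Rev ∩ connEvent ends a₁ o) -
        (β * prob p (TEvent ends a₁ a₂ a₃ ∩ connEvent ends a₁ o) -
          expect p (fun ω => iI ends a₂ a₃ ω * (uO p ends a₁ a₂ b ω * uO p ends a₁ a₂ o ω))) := by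
    have split : (fun ω => ({W : Set V | o ∈ W}).indicator (1 : Set V → R) (cluster ends ω a₁) *
        (β - defB p ends a₁ a₃ b (cluster ends ω a₂)) * Rev.indicator 1 ω) =
        fun ω => β * (({W : Set V | o ∈ W}).indicator (1 : Set V → R) (cluster ends ω a₁) *
            Rev.indicator 1 ω) -
          defB p ends a₁ a₃ b (cluster ends ω a₂) *
            ({W : Set V | o ∈ W}).indicator (1 : Set V → R) (cluster ends ω a₁) * rI ends a₁ a₂ ω := by
      funext ω
      have := iI_mul_indicator_R (R := R) ends a₁ a₂ a₃ ω
      rw [← hRev] at this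
      rw [defB_apply]
      calc ({W : Set V | o ∈ W}).indicator (1 : Set V → R) (cluster ends ω a₁) *
            (β - iI ends a₂ a₃ ω * (β - delClusterProb p ends a₁ {W | b ∈ W} (cluster ends ω a₂))) *
            Rev.indicator 1 ω
          = β * (({W : Set V | o ∈ W}).indicator (1 : Set V → R) (cluster ends ω a₁) *
              Rev.indicator 1 ω) -
            (iI ends a₂ a₃ ω * Rev.indicator 1 ω) *
              (β - delClusterProb p ends a₁ {W | b ∈ W} (cluster ends ω a₂)) *
              ({W : Set V | o ∈ W}).indicator (1 : Set V → R) (cluster ends ω a₁) := by ring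
        _ = _ := by rw [this]; ring
    rw [split]
    show expect p ((fun ω => β * (({W : Set V | o ∈ W}).indicator (1 : Set V → R) (cluster ends ω a₁) *
        Rev.indicator 1 ω)) - (fun ω => defB p ends a₁ a₃ b (cluster ends ω a₂) *
        ({W : Set V | o ∈ W}).indicator (1 : Set V → R) (cluster ends ω a₁) * rI ends a₁ a₂ ω)) = _
    rw [expect_sub, expect_const_mul, e1, tower, mass_TbL]
    congr 1
    unfold expect
    rw [Finset.mul_sum, ← Finset.sum_sub_distrib]
    refine Finset.sum_congr rfl fun ω _ => ?_
    beta_reduce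
    rw [defB_apply]
    have hub := rI_mul_delClusterProb p ends a₁ a₂ b ω
    have huo := rI_mul_delClusterProb p ends a₁ a₂ o ω
    have hrr := rI_mul_self (R := R) ends a₁ a₂ ω
    calc weight p ω * (iI ends a₂ a₃ ω * (β - delClusterProb p ends a₁ {W | b ∈ W} (cluster ends ω a₂)) *
            delClusterProb p ends a₁ {W | o ∈ W} (cluster ends ω a₂) * rI ends a₁ a₂ ω)
        = weight p ω * (iI ends a₂ a₃ ω * (β * (rI ends a₁ a₂ ω *
              delClusterProb p ends a₁ {W | o ∈ W} (cluster ends ω a₂)) -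
            (rI ends a₁ a₂ ω * delClusterProb p ends a₁ {W | b ∈ W} (cluster ends ω a₂)) *
              (rI ends a₁ a₂ ω * delClusterProb p ends a₁ {W | o ∈ W} (cluster ends ω a₂)))) := by
          rw [show rI ends a₁ a₂ ω * delClusterProb p ends a₁ {W | b ∈ W} (cluster ends ω a₂) *
              (rI ends a₁ a₂ ω * delClusterProb p ends a₁ {W | o ∈ W} (cluster ends ω a₂)) =
              (rI ends a₁ a₂ ω * rI ends a₁ a₂ ω) *
                (delClusterProb p ends a₁ {W | b ∈ W} (cluster ends ω a₂) *
                  delClusterProb p ends a₁ {W | o ∈ W} (cluster ends ω a₂)) by ring, hrr]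
          ring
      _ = β * (weight p ω * (iI ends a₂ a₃ ω * uO p ends a₁ a₂ o ω)) -
            weight p ω * (iI ends a₂ a₃ ω * (uO p ends a₁ a₂ b ω * uO p ends a₁ a₂ o ω)) := by
          rw [hub, huo]; ring
  -- assemble
  rw [e1, e2, e3] at h
  nlinarith [h]

/-- **`D(β, γ) ≥ 0` on every instance** — the open piece of the degree-one-root contraction is a
theorem: `0 ≤ Dmix = D·E[(L_b − β)(L_o − γ); T]`. -/
theorem Dmix_nonneg (p : E → R) (hp : IsProbVec p) (ends : E → Sym2 V) (o a₁ a₂ a₃ b : V) :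
    0 ≤ Dmix p ends o a₁ a₂ a₃ b := by
  classical
  have hc := cross_deficit p hp ends o a₁ a₂ a₃ b
  -- Harris in the fibre: `E[m u_b u_o] ≤ P(T, bL, oL)`
  have hH : expect p (fun ω => iI ends a₂ a₃ ω * (uO p ends a₁ a₂ b ω * uO p ends a₁ a₂ o ω)) ≤
      prob p (TEvent ends a₁ a₂ a₃ ∩ connEvent ends a₁ b ∩ connEvent ends a₁ o) := by
    rw [mass_TbLoL]
    exact expect_mono hp fun ω =>
      mul_le_mul_of_nonneg_left (uO_mul_uO_le p hp ends o a₁ a₂ b ω) (iI_nonneg ends a₂ a₃ ω)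
  -- `R = PD ⊔ T`
  have hR := ISplit.prob_PD_add_T p ends a₁ a₂ a₃ Set.univ
  simp only [Set.inter_univ] at hR
  have hRo := ISplit.prob_PD_add_T p ends a₁ a₂ a₃ (connEvent ends a₁ o)
  -- the shifts
  have hb := T_bL_le_beta_mul p hp ends a₁ a₂ a₃ b
  have ho := D_mul_ToL_le_Do_mul_T p hp ends o a₁ a₂ a₃
  have hpo := PD_oL_le_Do p hp ends o a₁ a₂ a₃
  have h0Z : 0 ≤ prob p (avoidAll ends a₁ {a₂, a₃}) := prob_nonneg hp _
  have h0D : 0 ≤ prob p (PDEvent ends a₁ a₂ a₃) := prob_nonneg hp _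
  have h0t : 0 ≤ prob p (TEvent ends a₁ a₂ a₃) := prob_nonneg hp _
  -- `Dmix_R ≥ 0`
  have hDR : 0 ≤ prob p (avoidAll ends a₁ {a₂, a₃}) *
        prob p (TEvent ends a₁ a₂ a₃ ∩ connEvent ends a₁ b ∩ connEvent ends a₁ o) -
      beta p ends a₁ b * prob p (avoidAll ends a₁ {a₂, a₃}) *
        prob p (TEvent ends a₁ a₂ a₃ ∩ connEvent ends a₁ o) -
      prob p (avoidAll ends a₁ {a₂, a₃} ∩ connEvent ends a₁ o) *
        prob p (TEvent ends a₁ a₂ a₃ ∩ connEvent ends a₁ b) +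
      beta p ends a₁ b * prob p (avoidAll ends a₁ {a₂, a₃} ∩ connEvent ends a₁ o) *
        prob p (TEvent ends a₁ a₂ a₃) := by
    nlinarith [hc, mul_le_mul_of_nonneg_left hH h0Z]
  -- `Z·Dmix = D·Dmix_R + (β·t − t_b)·(Z·D_o − D·r_o)`
  have key : prob p (avoidAll ends a₁ {a₂, a₃}) * Dmix p ends o a₁ a₂ a₃ b =
      prob p (PDEvent ends a₁ a₂ a₃) *
        (prob p (avoidAll ends a₁ {a₂, a₃}) *
            prob p (TEvent ends a₁ a₂ a₃ ∩ connEvent ends a₁ b ∩ connEvent ends a₁ o) -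
          beta p ends a₁ b * prob p (avoidAll ends a₁ {a₂, a₃}) *
            prob p (TEvent ends a₁ a₂ a₃ ∩ connEvent ends a₁ o) -
          prob p (avoidAll ends a₁ {a₂, a₃} ∩ connEvent ends a₁ o) *
            prob p (TEvent ends a₁ a₂ a₃ ∩ connEvent ends a₁ b) +
          beta p ends a₁ b * prob p (avoidAll ends a₁ {a₂, a₃} ∩ connEvent ends a₁ o) *
            prob p (TEvent ends a₁ a₂ a₃)) +
      (beta p ends a₁ b * prob p (TEvent ends a₁ a₂ a₃) -
          prob p (TEvent ends a₁ a₂ a₃ ∩ connEvent ends a₁ b)) *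
        (prob p (avoidAll ends a₁ {a₂, a₃}) * Do p ends o a₁ a₂ a₃ -
          prob p (PDEvent ends a₁ a₂ a₃) * prob p (avoidAll ends a₁ {a₂, a₃} ∩ connEvent ends a₁ o)) := by
    unfold Dmix; ring
  have hZD : 0 ≤ prob p (avoidAll ends a₁ {a₂, a₃}) * Do p ends o a₁ a₂ a₃ -
      prob p (PDEvent ends a₁ a₂ a₃) * prob p (avoidAll ends a₁ {a₂, a₃} ∩ connEvent ends a₁ o) := by
    rw [← hR, ← hRo]
    nlinarith [mul_le_mul_of_nonneg_left hpo h0D, ho]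
  have hprod : 0 ≤ prob p (avoidAll ends a₁ {a₂, a₃}) * Dmix p ends o a₁ a₂ a₃ b := by
    rw [key]
    have := mul_nonneg h0D hDR
    have := mul_nonneg (sub_nonneg.2 hb) hZD
    linarith
  rcases eq_or_lt_of_le h0Z with hZ | hZ
  · -- degenerate: `Z = 0`, so `D = t = 0` and `Dmix = 0`
    rw [← hR] at hZ
    have hD : prob p (PDEvent ends a₁ a₂ a₃) = 0 := by linarith
    have ht : prob p (TEvent ends a₁ a₂ a₃) = 0 := by linarith
    have htb : prob p (TEvent ends a₁ a₂ a₃ ∩ connEvent ends a₁ b) = 0 :=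
      le_antisymm (ht ▸ prob_inter_le_left hp _ _) (prob_nonneg hp _)
    unfold Dmix
    rw [hD, ht, htb]
    ring_nf
    exact le_refl _
  · exact nonneg_of_mul_nonneg_right hprod hZ

end Main

section Contraction

variable {V : Type*} {E : Type*} [Fintype E] [DecidableEq E] [Fintype V] [DecidableEq V]
  {R : Type*} [Field R] [LinearOrder R] [IsStrictOrderedRing R]
variable {ends : E → Sym2 V} {p : E → R} {e : E} {a₂ z : V}

/-- **THE DEGREE-ONE-ROOT CONTRACTION OF (HCOV)**: at a pendant root edge `e = {a₂, z}` (the only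
edge at `a₂`), `(HCOV)` at the contraction (the open pin, `a₂ ≡ z`) gives `(HCOV)` at the pendant
instance at every weight of the edge, for every non-degenerate contracted instance (`0 < D₀·D`). -/
theorem HCov_pendant_root (hp : IsProbVec p) (he : p e ≠ 1) (hleaf : ∀ f, a₂ ∈ ends f → f = e)
    (hends : ends e = s(a₂, z)) {o a₁ a₃ b : V} (ho : o ≠ a₂) (h1 : a₁ ≠ a₂) (h3 : a₃ ≠ a₂)
    (hb : b ≠ a₂) (h₁ : HCov (Function.update p e 1) ends o a₁ a₂ a₃ b)
    (hpos : 0 < D0 (Function.update p e 1) ends a₁ a₃ *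
      prob (Function.update p e 1) (PDEvent ends a₁ a₂ a₃)) :
    HCov p ends o a₁ a₂ a₃ b :=
  HCov_pendant_root_of_Dmix hp he hleaf hends ho h1 h3 hb h₁
    (Dmix_nonneg (Function.update p e 1) (hp.update e zero_le_one le_rfl) ends o a₁ a₂ a₃ b) hpos

end Contraction

end FirstOrder

end CovForm

end Summit.Ventures.PercRepro2
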